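import Summits.NavierStokesRegularity.NavierStokesRegularity.Theorems.StrainDoorsSegregationVacuity
import HarnessLib

/-!
# Strain doors — THE VIRIAL IDENTITIES OF THE DOOR FRAME (tested form, pressure moments, energy; non-segregation at every instant)

LEAD S-door engine plate (ns-s30-p1 g5), companion of `StrainDoorsVirialLiquidation.lean` / `StrainDoorsSegregationVacuity.lean`
(the D11 analysis of nsreg-p1's ROUND-48/49).  Four readings, all in the standing frame of the doors D5–D12 (classical unforced
solution on `[0,T)`, `ν > 0`, Sobolev-bounded on every `[0,T'']`) or below it:

* `integral_hessian_apply_self_eq_integral_mul_divergence_convect` — THE GENERAL TESTED VIRIAL IDENTITY (pure calculus):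
  `u ∈ C²(ℝ³;ℝ³)` divergence free, `θ ∈ C²_c` ⇒ `∫ D²θ(u,u) = ∫ θ·div((u·∇)u)`.
* `integral_hessian_apply_self_eq_neg_integral_mul_qDensity` — THE PRESSURE-MOMENT IDENTITY (frame, every `t ∈ [0,T)`, every
  `θ ∈ C²_c`): `∫ D²θ(u(t),u(t)) = −∫ θ·q(t) = −∫ θ·Δp(t)` (the pressure Poisson equation `Δp = q = ½|ω|² − |S|²` in tested
  form: velocity quadratic moments are pressure-Laplacian moments).
* `tendsto_integral_virialTest_mul_qDensity` ★★ — THE VIRIAL ENERGY IDENTITY (frame): with `θ_R = ½|x|²χ_R`,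
  `∫ θ_{n+1}·q(t) → −∫|u(t)|²` (`n → ∞`); equivalently `∫ |x|²χ_R(|S|² − ½|ω|²) → 2∫|u|²`: in the `|x|²`-moment sense the strain
  out-weighs half the enstrophy density by exactly twice the energy (trace of the tensor virial theorem; its case `q ≡ 0` is
  `eq_zero_of_divergence_convect_self_eq_zero`).
* `exists_nonsegregated_record_of_frame` ★ — NON-SEGREGATION AT EVERY STRAINED INSTANT (contrapositive of
  `strainQuad_le_of_D11_hypothesis_of_frame`): at every `0 < t < T`, for every `0 < δ < 1`, scales `r₀ < r₁` and level `l₀`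
  below `(1−δ)·⟪∇u(t,x₁)e₁,e₁⟫` for some `(x₁,e₁)`, some `δ`-almost record charged above `l₀` has a direction `y` with
  `K_ee(x−y)(q(t,y) − q(t,x)) < 0` — unconditionally, for every finite-energy classical flow.

HONEST FRAME: identities and a structural reading about a door HYPOTHESIS; no continuation criterion is strengthened;
item 0056 `NoTypeII` / 10661 / NS regularity are NOT proved; no blow-up is excluded.  `--supports stmt-NavierStokesRegularity-0056 --as helper`.
-/

noncomputable section

open MeasureTheory Set Function Filter InnerProductSpace Metric
open scoped RealInnerProductSpace ContDiff Topology Laplacian ENNReal NNReal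
open Real Literature.Analysis Literature.Analysis.FluidPDE Literature.Analysis.FluidPDE.VorticityDirectionDynamics

set_option linter.dupNamespace false

namespace Summit.NavierStokesRegularity.NavierStokesRegularity.Theorems.StrainDoors

/-- ★ THE GENERAL TESTED VIRIAL IDENTITY.  For `u ∈ C²(ℝ³;ℝ³)` divergence free and every compactly supported `θ ∈ C²`:
`∫ D²θ(x)(u(x),u(x)) dx = ∫ θ(x)·div((u·∇)u)(x) dx` (`= ∫ θ·tr((∇u)²)`; two integrations by parts, no decay of `u` needed). -/
theorem integral_hessian_apply_self_eq_integral_mul_divergence_convect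
    {u : (EuclideanSpace ℝ (Fin 3)) → (EuclideanSpace ℝ (Fin 3))} (hu : ContDiff ℝ 2 u)
    (hdiv : VectorCalculus.IsDivFree u) {θ : (EuclideanSpace ℝ (Fin 3)) → ℝ} (hθ : ContDiff ℝ 2 θ)
    (hθc : HasCompactSupport θ) :
    ∫ x, fderiv ℝ (fderiv ℝ θ) x (u x) (u x) = ∫ x, θ x * VectorCalculus.divergence (convect u u) x := by
  have hu1 : ContDiff ℝ 1 u := hu.of_le (by norm_cast)
  have hθ1 : ContDiff ℝ 1 θ := hθ.of_le (by norm_cast)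
  have hg1 := contDiff_one_gradient hθ
  have hgc := hasCompactSupport_gradient' hθc
  have hw1 : ContDiff ℝ 1 (convect u u) := by
    show ContDiff ℝ 1 fun x => fderiv ℝ u x (u x)
    exact (hu.fderiv_right (m := 1) (by norm_cast)).clm_apply hu1
  have A := integral_inner_convect_add_eq_zero (u := u) (v := u) (w := gradient θ) hu1 hu1 hg1 hgc
  have B := integral_mul_divergence_add_eq_zero_left hθ1 hw1 hθc
  have hA3 : ∫ x, VectorCalculus.divergence u x * ⟪u x, gradient θ x⟫ = 0 := by
    simp [hdiv _]
  rw [hA3, add_zero] at A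
  have hmid : ∫ x, ⟪u x, convect u (gradient θ) x⟫ = ∫ x, fderiv ℝ (fderiv ℝ θ) x (u x) (u x) := by
    refine integral_congr_ae (Eventually.of_forall fun x => ?_)
    show ⟪u x, convect u (gradient θ) x⟫ = fderiv ℝ (fderiv ℝ θ) x (u x) (u x)
    rw [show convect u (gradient θ) x = fderiv ℝ (gradient θ) x (u x) from rfl, inner_fderiv_gradient_apply hθ]
  linarith

/-- ★ THE PRESSURE-MOMENT IDENTITY (door frame, every `t ∈ [0,T)`, every test `θ ∈ C²_c`):
`∫ D²θ(x)(u(t,x),u(t,x)) dx = −∫ θ(x)·q(t,x) dx = −∫ θ·Δp(t)` (`div((u·∇)u) = −q = −Δp`, the pressure Poisson equation in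
tested form: the velocity quadratic moments ARE the pressure-Laplacian moments). -/
theorem integral_hessian_apply_self_eq_neg_integral_mul_qDensity {ν T : ℝ}
    {u : ℝ → (EuclideanSpace ℝ (Fin 3)) → (EuclideanSpace ℝ (Fin 3))} {p : ℝ → (EuclideanSpace ℝ (Fin 3)) → ℝ}
    (hsol : IsClassicalNSSolutionOn (Ico 0 T) ν 0 u p) {t : ℝ} (ht : t ∈ Ico 0 T)
    {θ : (EuclideanSpace ℝ (Fin 3)) → ℝ} (hθ : ContDiff ℝ 2 θ) (hθc : HasCompactSupport θ) :
    ∫ x, fderiv ℝ (fderiv ℝ θ) x (u t x) (u t x) = -∫ x, θ x * qDensity u t x ∧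
      ∫ x, fderiv ℝ (fderiv ℝ θ) x (u t x) (u t x) = -∫ x, θ x * (Δ (p t)) x := by
  have hu2 : ContDiff ℝ 2 (u t) := (hsol.contDiff_velocity ht).of_le (by norm_cast)
  have h := integral_hessian_apply_self_eq_integral_mul_divergence_convect hu2 (hsol.divFree t ht) hθ hθc
  have hdw : ∀ x, VectorCalculus.divergence (convect (u t) (u t)) x = -qDensity u t x := by
    intro x
    rw [divergence_convect_self_eq hu2 (hsol.divFree t ht)]
    have h1 := frobeniusNormSq_fderiv_eq_sq_norm_curl_add_trace (u t) x
    have h2 := qDensity_eq_norm_curl_sq_sub u t x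
    linarith
  have h1 : ∫ x, fderiv ℝ (fderiv ℝ θ) x (u t x) (u t x) = -∫ x, θ x * qDensity u t x := by
    rw [h, ← integral_neg]
    refine integral_congr_ae (Eventually.of_forall fun x => ?_)
    show θ x * VectorCalculus.divergence (convect (u t) (u t)) x = -(θ x * qDensity u t x)
    rw [hdw x]; ring
  refine ⟨h1, ?_⟩
  rw [h1, qDensity_eq_laplacian_pressure_fun hsol ht]

/-- ★★ THE VIRIAL ENERGY IDENTITY (door frame, every `t ∈ [0,T)`).  With `θ_R = ½|x|²·χ_R` the regularised second moment of
the Q-field converges to MINUS twice the kinetic energy... precisely: `∫ ½|x|²χ_{n+1}(x)·q(t,x) dx → −∫ |u(t,x)|² dx`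
(`n → ∞`).  Equivalently `∫ |x|²χ_R (|S|² − ½|ω|²) → 2∫|u|²`: in the `|x|²`-moment sense the strain ALWAYS out-weighs half the
enstrophy density, by exactly twice the energy — Q-excess (vorticity-dominated) regions are paid for by strain-dominated ones
farther out.  This is the trace of the tensor virial theorem; `eq_zero_of_divergence_convect_self_eq_zero` is its case `q ≡ 0`. -/
theorem tendsto_integral_virialTest_mul_qDensity {ν T : ℝ}
    {u : ℝ → (EuclideanSpace ℝ (Fin 3)) → (EuclideanSpace ℝ (Fin 3))} {p : ℝ → (EuclideanSpace ℝ (Fin 3)) → ℝ}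
    (hsol : IsClassicalNSSolutionOn (Ico 0 T) ν 0 u p) (hSob : ∀ T'' < T, HasBoundedSobolevNormsOn (Icc 0 T'') u)
    {t : ℝ} (ht : t ∈ Ico 0 T) :
    Tendsto (fun n : ℕ => ∫ x, (‖x‖ ^ 2 / 2 * cutoff ((n : ℝ) + 1) x) * qDensity u t x) atTop
      (𝓝 (-∫ x, ‖u t x‖ ^ 2)) := by
  obtain ⟨C₁, hC₁, h₁⟩ := exists_norm_fderiv_cutoff_le (E := EuclideanSpace ℝ (Fin 3))
  obtain ⟨C₂, hC₂, h₂⟩ := exists_norm_fderiv_fderiv_cutoff_le (E := EuclideanSpace ℝ (Fin 3))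
  set K : ℝ := 4 * C₁ + 2 * C₂ with hK
  have hK0 : 0 ≤ K := by positivity
  set v := u t with hv
  have hL2 : Integrable (fun x => ‖v x‖ ^ 2) := integrable_norm_sq_of_frame hsol hSob ht
  have hvc : Continuous v := (hsol.contDiff_velocity ht).continuous
  set err : ℝ → (EuclideanSpace ℝ (Fin 3)) → ℝ := fun R x =>
    2 * ⟪x, v x⟫ * fderiv ℝ (cutoff R) x (v x) + ‖x‖ ^ 2 / 2 * fderiv ℝ (fderiv ℝ (cutoff R)) x (v x) (v x) with herr
  have herr_le : ∀ R, 0 < R → ∀ x, |err R x| ≤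
      ({y : EuclideanSpace ℝ (Fin 3) | R ≤ ‖y‖}.indicator (fun y => K * ‖v y‖ ^ 2)) x := by
    intro R hR x
    by_cases hx : R ≤ ‖x‖
    · rw [indicator_of_mem (show x ∈ {y : EuclideanSpace ℝ (Fin 3) | R ≤ ‖y‖} from hx)]
      exact virialError_bound hR hC₁ hC₂ (h₁ R hR) (h₂ R hR) x (v x)
    · rw [indicator_of_notMem (show x ∉ {y : EuclideanSpace ℝ (Fin 3) | R ≤ ‖y‖} from hx)]
      obtain ⟨e1, e2⟩ := fderiv_cutoff_eq_zero_inside hR (lt_of_not_ge hx)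
      simp [herr, e1, e2]
  -- the identity `-∫ θ_R q = ∫ χ_R |v|² + ∫ err_R`
  have hid : ∀ R, 0 < R → ∫ x, (‖x‖ ^ 2 / 2 * cutoff R x) * qDensity u t x =
      -(∫ x, cutoff R x * ‖v x‖ ^ 2) - ∫ x, err R x := by
    intro R hR
    have hθ : ContDiff ℝ 2 (fun y : EuclideanSpace ℝ (Fin 3) => ‖y‖ ^ 2 / 2 * cutoff R y) := contDiff_virialTest R
    have hθc : HasCompactSupport (fun y : EuclideanSpace ℝ (Fin 3) => ‖y‖ ^ 2 / 2 * cutoff R y) :=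
      (hasCompactSupport_cutoff hR).mul_left
    have h0 := (integral_hessian_apply_self_eq_neg_integral_mul_qDensity hsol ht hθ hθc).1
    have hsplit : ∀ x, fderiv ℝ (fderiv ℝ (fun y : EuclideanSpace ℝ (Fin 3) => ‖y‖ ^ 2 / 2 * cutoff R y)) x (v x) (v x) =
        cutoff R x * ‖v x‖ ^ 2 + err R x := fun x => by
      rw [fderiv_fderiv_virialTest_apply]; simp only [herr]; ring
    have hi1 : Integrable fun x => cutoff R x * ‖v x‖ ^ 2 := by
      refine hL2.mono' (((contDiff_cutoff (n := 0) R).continuous.mul (hvc.norm.pow 2)).aestronglyMeasurable)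
        (Eventually.of_forall fun x => ?_)
      rw [Real.norm_eq_abs, abs_mul, abs_of_nonneg (sq_nonneg ‖v x‖)]
      calc |cutoff R x| * ‖v x‖ ^ 2 ≤ 1 * ‖v x‖ ^ 2 :=
            mul_le_mul_of_nonneg_right (abs_cutoff_le_one R x) (sq_nonneg _)
        _ = ‖v x‖ ^ 2 := one_mul _
    have hi2 : Integrable (err R) := by
      have hc : Continuous (err R) := by
        have hd1 : Continuous (fderiv ℝ (cutoff (E := EuclideanSpace ℝ (Fin 3)) R)) :=
          (contDiff_cutoff (n := 1) R).continuous_fderiv (by simp)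
        have hd2 : Continuous (fderiv ℝ (fderiv ℝ (cutoff (E := EuclideanSpace ℝ (Fin 3)) R))) :=
          ((contDiff_cutoff (n := 2) R).fderiv_right (m := 1) (by norm_cast)).continuous_fderiv (by simp)
        simp only [herr]
        fun_prop
      refine (hL2.const_mul K).mono' hc.aestronglyMeasurable (Eventually.of_forall fun x => ?_)
      rw [Real.norm_eq_abs]
      refine (herr_le R hR x).trans ?_
      by_cases hx : x ∈ {y : EuclideanSpace ℝ (Fin 3) | R ≤ ‖y‖}
      · rw [indicator_of_mem hx]
      · rw [indicator_of_notMem hx]; positivity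
    have hv' : ∀ x, u t x = v x := fun x => rfl
    simp_rw [hv'] at h0
    simp_rw [hsplit] at h0
    rw [integral_add hi1 hi2] at h0
    linarith
  -- the two limits
  have hlim1 : Tendsto (fun n : ℕ => ∫ x, cutoff ((n : ℝ) + 1) x * ‖v x‖ ^ 2) atTop (𝓝 (∫ x, ‖v x‖ ^ 2)) := by
    refine tendsto_integral_of_dominated_convergence (fun x => ‖v x‖ ^ 2) (fun n => ?_) hL2 (fun n => ?_) ?_
    · exact ((contDiff_cutoff (n := 0) _).continuous.mul (hvc.norm.pow 2)).aestronglyMeasurable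
    · refine Eventually.of_forall fun x => ?_
      rw [Real.norm_eq_abs, abs_mul, abs_of_nonneg (sq_nonneg ‖v x‖)]
      calc |cutoff ((n : ℝ) + 1) x| * ‖v x‖ ^ 2 ≤ 1 * ‖v x‖ ^ 2 :=
            mul_le_mul_of_nonneg_right (abs_cutoff_le_one _ x) (sq_nonneg _)
        _ = ‖v x‖ ^ 2 := one_mul _
    · refine Eventually.of_forall fun x => ?_
      have h := (tendsto_cutoff_natCast_add_one x).mul_const (‖v x‖ ^ 2)
      rwa [one_mul] at h
  have hlim2 : Tendsto (fun n : ℕ => ∫ x, err ((n : ℝ) + 1) x) atTop (𝓝 0) := by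
    have hdom : Tendsto (fun n : ℕ => ∫ x, {y : EuclideanSpace ℝ (Fin 3) | ((n : ℝ) + 1) ≤ ‖y‖}.indicator
        (fun y => K * ‖v y‖ ^ 2) x) atTop (𝓝 0) := by
      have h := tendsto_integral_of_dominated_convergence (F := fun (n : ℕ) x =>
          {y : EuclideanSpace ℝ (Fin 3) | ((n : ℝ) + 1) ≤ ‖y‖}.indicator (fun y => K * ‖v y‖ ^ 2) x) (f := fun _ => (0 : ℝ))
        (μ := volume) (fun x => K * ‖v x‖ ^ 2) (fun n => ?_) (hL2.const_mul K) (fun n => ?_) ?_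
      · simpa using h
      · exact ((hL2.const_mul K).indicator
          (isClosed_le continuous_const continuous_norm).measurableSet).aestronglyMeasurable
      · refine Eventually.of_forall fun x => ?_
        rw [Real.norm_eq_abs]
        by_cases hx : x ∈ {y : EuclideanSpace ℝ (Fin 3) | ((n : ℝ) + 1) ≤ ‖y‖}
        · rw [indicator_of_mem hx, abs_of_nonneg (by positivity)]
        · rw [indicator_of_notMem hx, abs_zero]; positivity
      · refine Eventually.of_forall fun x => ?_
        apply tendsto_const_nhds.congr'
        filter_upwards [eventually_gt_atTop ⌈‖x‖⌉₊] with n hn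
        have hlt : ‖x‖ < (n : ℝ) + 1 := by
          have := Nat.lt_of_ceil_lt hn
          linarith [this]
        rw [indicator_of_notMem]
        simp only [mem_setOf_eq, not_le]
        exact hlt
    refine squeeze_zero_norm (fun n => ?_) hdom
    rw [Real.norm_eq_abs]
    refine (abs_integral_le_integral_abs (f := err ((n : ℝ) + 1))).trans ?_
    refine integral_mono_of_nonneg (Eventually.of_forall fun x => abs_nonneg _) ?_
      (Eventually.of_forall (herr_le _ (by positivity)))
    exact (hL2.const_mul K).indicator (isClosed_le continuous_const continuous_norm).measurableSet
  have hfun : (fun n : ℕ => ∫ x, (‖x‖ ^ 2 / 2 * cutoff ((n : ℝ) + 1) x) * qDensity u t x) =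
      fun n : ℕ => -(∫ x, cutoff ((n : ℝ) + 1) x * ‖v x‖ ^ 2) - ∫ x, err ((n : ℝ) + 1) x :=
    funext fun n => hid _ (by positivity)
  rw [hfun]
  have := (hlim1.neg).sub hlim2
  simpa using this

/-- ★ NON-SEGREGATION AT EVERY STRAINED INSTANT (contrapositive of `strainQuad_le_of_D11_hypothesis_of_frame`).  In the door
frame at every time `0 < t < T`: for every tolerance `0 < δ < 1`, scales `0 < r₀ < r₁` and level `l₀ > 0` EXCEEDED by
`(1−δ)·⟪∇u(t,x₁)e₁,e₁⟫` at some point and unit direction, there is a `δ`-almost strain record `(x,e)` charged above `l₀`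
at which the Q-excess is NOT favourably segregated with respect to the magic cone: `K_ee(x−y)(q(t,y) − q(t,x)) < 0` for
some `y`.  An unconditional structural fact about every finite-energy classical flow (no blow-up hypothesis). -/
theorem exists_nonsegregated_record_of_frame {ν T : ℝ} (hν : 0 < ν)
    {u : ℝ → (EuclideanSpace ℝ (Fin 3)) → (EuclideanSpace ℝ (Fin 3))} {p : ℝ → (EuclideanSpace ℝ (Fin 3)) → ℝ}
    (hsol : IsClassicalNSSolutionOn (Ico 0 T) ν 0 u p) (hSob : ∀ T'' < T, HasBoundedSobolevNormsOn (Icc 0 T'') u)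
    {t : ℝ} (ht : t ∈ Ioo 0 T) {δ l₀ r₀ r₁ : ℝ} (hl₀ : 0 < l₀) (hδ : 0 < δ) (hδ1 : δ < 1) (hr₀ : 0 < r₀) (hr₁ : r₀ < r₁)
    {x₁ e₁ : EuclideanSpace ℝ (Fin 3)} (he₁ : ‖e₁‖ = 1) (hbig : l₀ < (1 - δ) * strainQuad u t x₁ e₁) :
    ∃ (x e y : EuclideanSpace ℝ (Fin 3)), IsStrainAlmostArgmax δ u t x e ∧ l₀ < strainQuad u t x e ∧
      newtonNearHess r₀ r₁ e e (x - y) * (qDensity u t y - qDensity u t x) < 0 := by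
  by_contra hcon
  push Not at hcon
  have hD11 : ∀ x e, IsStrainAlmostArgmax δ u t x e → l₀ < strainQuad u t x e →
      ∀ y, 0 ≤ newtonNearHess r₀ r₁ e e (x - y) * (qDensity u t y - qDensity u t x) :=
    fun x e hx hl y => hcon x e y hx hl
  have hle := strainQuad_le_of_D11_hypothesis_of_frame hν hsol hSob ht hl₀ hδ hδ1 hr₀ hr₁ hD11 x₁ he₁
  have h1δ : 0 < 1 - δ := by linarith
  have : (1 - δ) * strainQuad u t x₁ e₁ ≤ l₀ := by
    calc (1 - δ) * strainQuad u t x₁ e₁ ≤ (1 - δ) * (l₀ / (1 - δ)) := mul_le_mul_of_nonneg_left hle h1δ.le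
      _ = l₀ := by field_simp
  linarith

end Summit.NavierStokesRegularity.NavierStokesRegularity.Theorems.StrainDoors

end
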